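import Summits.QuantumFields.BalabanUV.Beta.GAN24.CombBornBorderLettersRaw
import Summits.QuantumFields.BalabanUV.Beta.GAN24.BornBorderUndressedRowAn1

/-!
# THE RAW UNDRESSED V-LINEAGE LETTER `hUv⁰` OF THE (III′) BORN ROW AT an1's SYMMETRISED BORDER — UNCONDITIONAL at `d = 3`, `2 ≤ Lc`, pin `cE = Lc^4`
# (M.77's RAW socket fed by `BornBorderUndressedRowAn1.exists_hUgV_three`)

NOT IN PRINT — OUR BOOKKEEPING (road-P2 = `b2b-balaban-gan24-p2` gen 56, 2026-08-25; row G-an2-4 ∕ (CONV-C), the (α-0) chain at row D1's literal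
OF RECORD (III′) `JsB12CombShSym`; [folklore] composition BY NAME; 0 `def`, 0 cite, 0 `def … : Prop`, 0 `sorry`).  Weight 0.  NEVER «G-an2-4 closed» as (CONV-C);
NOT D1, NOT BetaPertH, NOT continuum, NOT Clay; NO campaign opened (an2 W-4) — the LAST brick of the located `hUv⁰` transfer (road-P2 MEMO M-gan24p2-g56-1 §2(b)).

For `tabs : SymTables 3 Lc` with OFF-DIAGONAL border EQUAL TO an1's symmetrised border at a box root (`hVff hVmm`, `hV : tabs.V = symVhSAt (toSite rr) 3 Lc rfl`, `rr ∈ box (3+1) Lc` —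
the record's `symTablesAn1S2` at `rr = ctrOff`):
* **`exists_hUgV_raw_three`** — per lineage `i < k`, `(cE·Lc^8)^{k−i} • push₃ B_{i+1,k}³ Y⁰_i` (legs `respStep`, RAW table `cVH • tabs.V`) is a local stencil family with constant `C·θ^{k−i}`
  at one rate — the hypothesis `hUg` of M.77 `CombBornBorderLettersRaw.exists_hUv_raw_of_geometric` VERBATIM (`BornBorderUndressedRowAn1.exists_hUgV_three` at `rr`, `hV` rewritten);
* **`exists_hUv_raw_three`** — the summed RAW undressed letter `hUv⁰` of M.77 `exists_hBv_of_rawLetters`;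
* **`exists_hBv_three_of_rawContact (hCg⁰)`** — the (III′) V-born row letter `hV` of M.57 `exists_hB_of_sectors` from the RAW contact letter ALONE (M.77 `exists_hBv_of_rawGeometric`).
SCORE after this file (located): (III′) born ROW `hB ⟸ (hUv⁰ ✓ ∧ hCv⁰) ∧ (hUg-Λ ✓ ∧ hCg-Λ)` — BOTH undressed row letters DISCHARGED at the record's tables; what is left of the ROW
are the two CONTACT letters (`hCv⁰`: `𝒯 − 1` face insertions + `T″ − B`; `hCg-Λ`: `T″ − B` with `λ′ = λ + PsiFace`) — the OWNER's `PsiFace` ∕ conjugated-leg envelope words.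
The estimates inside are the TREE's road-S3 V legs ((N1), the K-slot) through the An1 rows — NO new estimate, NO value ∕ rate of Bałaban's tables asserted beyond them.
-/

noncomputable section

open Finset
open scoped BigOperators
open Literature.MathematicalPhysics.QuantumFieldTheory
open Literature.MathematicalPhysics.QuantumFieldTheory.Balaban1983to89
open Literature.MathematicalPhysics.QuantumFieldTheory.Balaban1983to89.Beta
open ExpKernelCalculus (MKer)
open AffineAveraging (Site box toSite)
open OneStepResolventKernel (Fib LocStencil)
open BalabanCompositeJets (respStep)
open Summit.QuantumFields.BalabanUV.Beta.HessKerDressedUnits (unitS)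
open Summit.QuantumFields.BalabanUV.Beta.SymmetrisedStepJets (SymTables)
open Summit.QuantumFields.BalabanUV.Beta.SymAveragingHessianCounts (symVhSAt)
open Summit.QuantumFields.BalabanUV.Beta.GAN24.CombesThomas (sfStep smStep KStepUnit)
open Summit.QuantumFields.BalabanUV.Beta.GAN24.Push3 (push₃)
open Summit.QuantumFields.BalabanUV.Beta.GAN24.AffineUnroll (transport)
open Summit.QuantumFields.BalabanUV.Beta.GAN24.SrecLinearPartEq (colM rowMM reslot)
open Summit.QuantumFields.BalabanUV.Beta.GAN24.CombWilsonSector (combBornOf)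
open Summit.QuantumFields.BalabanUV.Beta.GAN24.CombBornSector (combFreshAt combUnitStepMap)
open Summit.QuantumFields.BalabanUV.Beta.GAN24.CombBornBorderLettersRaw (exists_hUv_raw_of_geometric exists_hBv_of_rawGeometric)
open Summit.QuantumFields.BalabanUV.Beta.GAN24.BornBorderUndressedRowAn1 (exists_hUgV_three)

namespace Summit.QuantumFields.BalabanUV.Beta.GAN24.CombBornBorderUndressedRow

variable {Lc : ℕ} [NeZero Lc] (tabs : SymTables 3 Lc) (hVff : ∀ κ u x y (α β : Fin (3 + 1)), tabs.V κ u x y (Sum.inl α) (Sum.inl β) = 0)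
  (hVmm : ∀ κ u x y (μ ν : Fin (3 + 1)), tabs.V κ u x y (Sum.inr μ) (Sum.inr ν) = 0)

/-- NOT IN PRINT; OUR BOOKKEEPING ([folklore] assembly; UNCONDITIONAL).  **THE RAW UNDRESSED V-LINEAGE LETTER OF THE (III′) BORN ROW HOLDS AT an1's SYMMETRISED BORDER**
(`d = 3`, `2 ≤ Lc`, `cE = Lc^4`, `tabs.V = symVhSAt (toSite rr) 3 Lc`): the hypothesis `hUg` of M.77 `exists_hUv_raw_of_geometric`, VERBATIM (`BornBorderUndressedRowAn1.exists_hUgV_three`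
at the root `rr`). -/
theorem exists_hUgV_raw_three (hLc : 2 ≤ Lc) {rr : Fin (3 + 1) → ℕ} (hrr : rr ∈ box (3 + 1) Lc) (hV : tabs.V = symVhSAt (toSite rr) 3 Lc rfl)
    {cE : ℝ} (hcE : cE = (Lc : ℝ) ^ (3 + 1)) (cVH : ℝ) :
    ∃ C θ δ : ℝ, 0 ≤ C ∧ 0 ≤ θ ∧ θ < 1 ∧ 0 < δ ∧ ∀ k i : ℕ, i < k →
      LocStencil (fun κ' u' => (cE * (Lc : ℝ) ^ (2 * (3 + 1))) ^ (k - i) •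
        push₃ (respStep (d := 3) (Lc ^ (i + 1)) (Lc ^ k)) (respStep (d := 3) (Lc ^ (i + 1)) (Lc ^ k)) (respStep (d := 3) (Lc ^ (i + 1)) (Lc ^ k))
          (fun κ u => -(push₃ (-respStep (d := 3) (Lc ^ i) (Lc ^ (i + 1))) (colM (KStepUnit (d := 3) Lc i) Lc)
                (respStep (d := 3) (Lc ^ i) (Lc ^ (i + 1))) (reslot Sum.inl Sum.inr fun κ u => cVH • SymTables.V tabs κ u) κ u
            + push₃ (rowMM (KStepUnit (d := 3) Lc i) Lc) (respStep (d := 3) (Lc ^ i) (Lc ^ (i + 1)))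
                (respStep (d := 3) (Lc ^ i) (Lc ^ (i + 1))) (reslot Sum.inr Sum.inl fun κ u => cVH • SymTables.V tabs κ u) κ u)) κ' u')
        (C * θ ^ (k - i)) δ := by
  obtain ⟨C, θ, δ, hC, hθ0, hθ1, hδ, h⟩ := exists_hUgV_three (Lc := Lc) hLc hcE cVH
  refine ⟨C, θ, δ, hC, hθ0, hθ1, hδ, fun k i hik => ?_⟩
  rw [hV]
  exact h rr hrr k i hik

/-- NOT IN PRINT; OUR BOOKKEEPING ([folklore] assembly; UNCONDITIONAL).  **THE SUMMED RAW UNDRESSED LETTER `hUv⁰` OF M.77 HOLDS** at an1's symmetrised border. -/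
theorem exists_hUv_raw_three (hLc : 2 ≤ Lc) {rr : Fin (3 + 1) → ℕ} (hrr : rr ∈ box (3 + 1) Lc) (hV : tabs.V = symVhSAt (toSite rr) 3 Lc rfl)
    {cE : ℝ} (hcE : cE = (Lc : ℝ) ^ (3 + 1)) (cVH : ℝ) :
    ∃ C δ : ℝ, 0 < δ ∧ ∀ k : ℕ,
      LocStencil (∑ i ∈ Finset.range k, fun κ' u' => (cE * (Lc : ℝ) ^ (2 * (3 + 1))) ^ (k - i) •
        push₃ (respStep (d := 3) (Lc ^ (i + 1)) (Lc ^ k)) (respStep (d := 3) (Lc ^ (i + 1)) (Lc ^ k)) (respStep (d := 3) (Lc ^ (i + 1)) (Lc ^ k))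
          (fun κ u => -(push₃ (-respStep (d := 3) (Lc ^ i) (Lc ^ (i + 1))) (colM (KStepUnit (d := 3) Lc i) Lc)
                (respStep (d := 3) (Lc ^ i) (Lc ^ (i + 1))) (reslot Sum.inl Sum.inr fun κ u => cVH • SymTables.V tabs κ u) κ u
            + push₃ (rowMM (KStepUnit (d := 3) Lc i) Lc) (respStep (d := 3) (Lc ^ i) (Lc ^ (i + 1)))
                (respStep (d := 3) (Lc ^ i) (Lc ^ (i + 1))) (reslot Sum.inr Sum.inl fun κ u => cVH • SymTables.V tabs κ u) κ u)) κ' u') C δ :=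
  exists_hUv_raw_of_geometric tabs cE cVH (exists_hUgV_raw_three tabs hLc hrr hV hcE cVH)

include hVff hVmm in
/-- NOT IN PRINT; OUR PROOF ATTEMPT — CONDITIONAL ON ONE LETTER ([folklore] assembly).  **THE (III′) V-BORN ROW LETTER `hV` OF M.57 FROM THE RAW CONTACT LETTER `hCg⁰` ALONE**
at an1's symmetrised border (the RAW undressed row and the source letter are discharged): `hCg⁰` (per lineage, geometric) ⇒ `∃ C δ, 0 < δ ∧ ∀ k, LocStencil (unitS_k (combBornOf Lc tabs cE cVH 0 k)) C δ`.
NOT `hB` (the Λ half is M.76), NOT (hS, hSall), NEVER «G-an2-4 closed». -/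
theorem exists_hBv_three_of_rawContact (hLc : 2 ≤ Lc) {rr : Fin (3 + 1) → ℕ} (hrr : rr ∈ box (3 + 1) Lc) (hV : tabs.V = symVhSAt (toSite rr) 3 Lc rfl)
    {cE : ℝ} (hcE : cE = (Lc : ℝ) ^ (3 + 1)) (cVH : ℝ)
    (hCg : ∃ C θ δ : ℝ, 0 ≤ C ∧ 0 ≤ θ ∧ θ < 1 ∧ 0 < δ ∧ ∀ k i : ℕ, i < k →
      LocStencil (transport (combUnitStepMap Lc cE) (i + 1) (k - 1 - i) (combUnitStepMap Lc cE i (fun κ u => cVH • tabs.V κ u))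
        - fun κ' u' => (cE * (Lc : ℝ) ^ (2 * (3 + 1))) ^ (k - i) •
          push₃ (respStep (d := 3) (Lc ^ (i + 1)) (Lc ^ k)) (respStep (d := 3) (Lc ^ (i + 1)) (Lc ^ k)) (respStep (d := 3) (Lc ^ (i + 1)) (Lc ^ k))
            (fun κ u => -(push₃ (-respStep (d := 3) (Lc ^ i) (Lc ^ (i + 1))) (colM (KStepUnit (d := 3) Lc i) Lc)
                  (respStep (d := 3) (Lc ^ i) (Lc ^ (i + 1))) (reslot Sum.inl Sum.inr fun κ u => cVH • SymTables.V tabs κ u) κ u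
              + push₃ (rowMM (KStepUnit (d := 3) Lc i) Lc) (respStep (d := 3) (Lc ^ i) (Lc ^ (i + 1)))
                  (respStep (d := 3) (Lc ^ i) (Lc ^ (i + 1))) (reslot Sum.inr Sum.inl fun κ u => cVH • SymTables.V tabs κ u) κ u)) κ' u') (C * θ ^ (k - i)) δ) :
    ∃ C δ : ℝ, 0 < δ ∧ ∀ k : ℕ, LocStencil (unitS (sfStep Lc k) (smStep 3 Lc k) (combBornOf Lc tabs cE cVH 0 k)) C δ :=
  exists_hBv_of_rawGeometric tabs hVff hVmm cE cVH (exists_hUgV_raw_three tabs hLc hrr hV hcE cVH) hCg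

end Summit.QuantumFields.BalabanUV.Beta.GAN24.CombBornBorderUndressedRow

end
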